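import Summits.BirchSwinnertonDyer.BirchSwinnertonDyer.Theorems.ByReductionTypeAtTwoRankOneAtTwoOffBigImageOddLocalEnginePrescribedPrime
import HarnessLib

/-!
# Route `ByReductionTypeAtTwo`, crux `RankOneAtTwoOffBigImageOddLocal` (stmt-BirchSwinnertonDyer-23716), line
# `refined_kolyvagin_tamagawa_shift_at_two` — ENGINE PORT `c₀ ↦ h₀` (regular element): §J″ the EIGENLINES and COINVARIANTS of the regular involution (card E4-γ, replacement (γ3))

Lead prover `prover-cruxlead-stmt-BirchSwinnertonDyer-23716-g2` (2026-08-28).  The line card's E4-γ PORT PRINCIPLE (planning memo, not formalised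
before this file) names the one change of LINEAR ALGEBRA when Gross's / McCallum's local computations at a Kolyvagin prime are run with a REGULAR
Frobenius `h ~ [[1,1],[0,-1]]` on `T = E[2^M] ≅ (ℤ/2^M)²` instead of complex conjugation `c₀ ~ diag(1,-1)` (odd `p`): «`E[p^M] = E⁺ ⊕ E⁻`, free
eigenlines» ↦ «the two `h`-eigen-sublattices `ker(h ∓ 1)` are free of rank one, of index `2^M`, and the COINVARIANT modules `T/(h ∓ 1)T` are free
of rank one» — at `p = 2` the two eigenlines do NOT span `T` (together they have index `2^M`), but every
quotient / kernel that a local formula of Gross §8 / McCallum §4 reads (`H¹_f(K_λ, E[2^M])^± `, `H¹_s(K_λ, E[2^M])^±`, `E(K_λ)/2^M` modulo the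
`τ_λ = h`-action) is still CYCLIC OF ORDER `2^M`, which is what the exact-order bookkeeping needs.  This file records these facts for the matrix
`reg b` of §J (`…EngineRegularInvolution.lean`), complementing §J (`Ĥ⁰ = 0`, fixed vectors `= (ℤ/q)•b₀`) and §J′ (`Ĥ⁻¹ = 0`, anti-fixed vectors
`= (ℤ/q)•(b₀ - 2b₁)`, `…EnginePrescribedPrime.lean`):

* `reg_sub_self`, `reg_add_self` — `(reg - 1) X = x₁ • (b₀ - 2•b₁)`, `(reg + 1) X = (2x₀ + x₁) • b₀` (closed forms of the two images);
* the COINVARIANT functionals `X ↦ 2x₀ + x₁` (sign `-`) and `X ↦ x₁` (sign `+`), written in coordinates (no new definition):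
  `coinvMinus_surjective` / `coinvPlus_surjective` and the exactness `coinvMinus_eq_zero_iff : 2x₀ + x₁ = 0 ↔ ∃ Y, X = reg b Y - Y`,
  `coinvPlus_eq_zero_iff : x₁ = 0 ↔ ∃ Y, X = reg b Y + Y`; i.e. `T/(reg - 1)T ≅ ZMod q ≅ T/(reg + 1)T`, free of rank one
  (for `diag(1,-1)` the corresponding quotients are `ZMod q ⊕ ZMod 2`-shaped at `p = 2` — the lost bit);
* `reg_eq_self_iff`, `reg_eq_neg_iff` — the eigenlines in closed form: `reg X = X ↔ x₁ = 0`, `reg X = -X ↔ x₁ = -2x₀`;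
* `smul_basis_zero_eq_zero_iff`, `smul_antiVector_eq_zero_iff` — both eigenlines `(ZMod q)•b₀`, `(ZMod q)•(b₀ - 2b₁)` are FREE of rank one
  (`a • v = 0 ↔ a = 0`).

Pure `ZMod q`-module algebra (any `q`), no definitions, no curve input.  Nothing here proves the crux,
`BSDp W 2`, BSD or the summit; no registered stub is discharged (engine inputs only).  BSD is not proved.

Refs: [GrossLMS1991] §8 Prop. 8.1; [McCallumLMS1991] §4 (4.4), §5.
-/

set_option linter.dupNamespace false -- tree convention: `Summit.BirchSwinnertonDyer.BirchSwinnertonDyer.Theorems` (summit = sub-problem)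
set_option autoImplicit false

noncomputable section

namespace Summit.BirchSwinnertonDyer.BirchSwinnertonDyer.Theorems.OffBigImageOddLocalAtTwo.Engine

/-! ## §J″  Eigenlines and coinvariants of `reg b = [[1,1],[0,-1]]` -/

section RegularEigenlines

variable {q : ℕ} {T : Type*} [AddCommGroup T] [Module (ZMod q) T] (b : Module.Basis (Fin 2) (ZMod q) T)

/-- Closed form of `(reg - 1)`: `reg X - X = x₁ • (b₀ - 2 • b₁)`. [folklore] -/
theorem reg_sub_self (X : T) : reg b X - X = b.repr X 1 • (b 0 - (2 : ZMod q) • b 1) := by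
  refine b.ext_elem fun i ↦ ?_
  fin_cases i
  · simp [repr_reg_zero]
  · simp [repr_reg_one]; ring

/-- Closed form of `(reg + 1)`: `reg X + X = (2x₀ + x₁) • b₀`. [folklore] -/
theorem reg_add_self (X : T) : reg b X + X = (2 * b.repr X 0 + b.repr X 1) • b 0 := by
  refine b.ext_elem fun i ↦ ?_
  fin_cases i
  · simp [repr_reg_zero]; ring
  · simp [repr_reg_one]

/-- The `(-1)`-coinvariant functional `X ↦ 2x₀ + x₁` kills `(reg - 1)T`. [folklore] -/
theorem coinvMinus_reg_sub_self (Y : T) : 2 * b.repr (reg b Y - Y) 0 + b.repr (reg b Y - Y) 1 = 0 := by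
  simp [repr_reg_zero, repr_reg_one]; ring

/-- The `(+1)`-coinvariant functional `X ↦ x₁` kills `(reg + 1)T`. [folklore] -/
theorem coinvPlus_reg_add_self (Y : T) : b.repr (reg b Y + Y) 1 = 0 := by
  simp [repr_reg_one]

/-- The `(-1)`-coinvariant functional `X ↦ 2x₀ + x₁` is ONTO `ZMod q`: `a • b₁ ↦ a`. [folklore] -/
theorem coinvMinus_surjective (a : ZMod q) : 2 * b.repr (a • b 1) 0 + b.repr (a • b 1) 1 = a := by
  simp

/-- The `(+1)`-coinvariant functional `X ↦ x₁` is ONTO `ZMod q`: `a • b₁ ↦ a`. [folklore] -/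
theorem coinvPlus_surjective (a : ZMod q) : b.repr (a • b 1) 1 = a := by
  simp

/-- **Exactness at `T/(reg - 1)T`**: `ker coinvMinus = (reg - 1)T` — a vector with `2x₀ + x₁ = 0` is `reg Y - Y` for `Y = -x₀ • b₁`.
Hence `T/(reg - 1)T ≅ ZMod q`, free of rank one (the `(-1)`-coinvariants of the regular involution lose no bit). [folklore] -/
theorem coinvMinus_eq_zero_iff (X : T) : 2 * b.repr X 0 + b.repr X 1 = 0 ↔ ∃ Y : T, X = reg b Y - Y := by
  constructor
  · intro h
    refine ⟨b.repr X 0 • b 1, ?_⟩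
    rw [reg_sub_self]
    refine b.ext_elem fun i ↦ ?_
    fin_cases i
    · simp
    · simp; linear_combination h
  · rintro ⟨Y, rfl⟩
    exact coinvMinus_reg_sub_self b Y

/-- **Exactness at `T/(reg + 1)T`**: `ker coinvPlus = (reg + 1)T` — a vector with `x₁ = 0` is `reg Y + Y` for `Y = x₀ • b₁`
(`b₁ + reg b₁ = b₀`).  Hence `T/(reg + 1)T ≅ ZMod q`, free of rank one. [folklore] -/
theorem coinvPlus_eq_zero_iff (X : T) : b.repr X 1 = 0 ↔ ∃ Y : T, X = reg b Y + Y := by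
  constructor
  · intro h
    refine ⟨b.repr X 0 • b 1, ?_⟩
    rw [reg_add_self]
    refine b.ext_elem fun i ↦ ?_
    fin_cases i
    · simp
    · simp [h]
  · rintro ⟨Y, rfl⟩
    exact coinvPlus_reg_add_self b Y

/-- The `(+1)`-eigenline in closed form: `reg X = X ↔ x₁ = 0` (then `X = x₀ • b₀`, `eq_smul_basis_zero_of_reg_eq`). [folklore] -/
theorem reg_eq_self_iff (X : T) : reg b X = X ↔ b.repr X 1 = 0 := by
  constructor
  · exact repr_one_eq_zero_of_reg_eq b
  · intro h
    refine b.ext_elem fun i ↦ ?_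
    fin_cases i
    · simp [repr_reg_zero, h]
    · simp [repr_reg_one, h]

/-- The `(-1)`-eigenline in closed form: `reg X = -X ↔ x₁ = -(2x₀)` (then `X = x₀ • (b₀ - 2b₁)`, `eq_of_reg_eq_neg`). [folklore] -/
theorem reg_eq_neg_iff (X : T) : reg b X = -X ↔ b.repr X 1 = -(2 * b.repr X 0) := by
  constructor
  · exact repr_one_eq_of_reg_eq_neg b
  · intro h
    refine b.ext_elem fun i ↦ ?_
    fin_cases i
    · simp [repr_reg_zero, h]; ring
    · simp [repr_reg_one]

/-- The `(+1)`-eigenline `(ZMod q) • b₀` is FREE of rank one: `a • b₀ = 0 ↔ a = 0`. [folklore] -/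
theorem smul_basis_zero_eq_zero_iff (a : ZMod q) : a • b 0 = 0 ↔ a = 0 := by
  constructor
  · intro h
    have := congrArg (fun Z ↦ b.repr Z 0) h
    simpa using this
  · rintro rfl; simp

/-- The `(-1)`-eigenline `(ZMod q) • (b₀ - 2b₁)` is FREE of rank one: `a • (b₀ - 2•b₁) = 0 ↔ a = 0` (read the `b₀`-coordinate). [folklore] -/
theorem smul_antiVector_eq_zero_iff (a : ZMod q) : a • (b 0 - (2 : ZMod q) • b 1) = 0 ↔ a = 0 := by
  constructor
  · intro h
    have := congrArg (fun Z ↦ b.repr Z 0) h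
    simpa using this
  · rintro rfl; simp

/-- The anti-fixed vector `b₀ - 2b₁` spans the `(-1)`-eigenline: `reg (b₀ - 2•b₁) = -(b₀ - 2•b₁)`. [folklore] -/
theorem reg_antiVector : reg b (b 0 - (2 : ZMod q) • b 1) = -(b 0 - (2 : ZMod q) • b 1) := by
  rw [reg_eq_neg_iff]
  simp

end RegularEigenlines

end Summit.BirchSwinnertonDyer.BirchSwinnertonDyer.Theorems.OffBigImageOddLocalAtTwo.Engine

end
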